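import Summits.ValiantsHypothesis.ValiantsHypothesis.Theorems.DivisionGapPerDivisionHardStubDescent
import Summits.ValiantsHypothesis.ValiantsHypothesis.Theorems.DivisionGapPerDivisionHardStubSparseRigidCount
import Summits.ValiantsHypothesis.ValiantsHypothesis.Theorems.DivisionGapPerDivisionHardStubSparseRigidFlow

/-!
# Crux `DivisionGap.PerDivisionHard` (stmt-ValiantsHypothesis-5065), line
`pair-descent-jss-endpoint` — stub `stub_fibreTorus` (the projected fibre is torus-homogeneous)

For a placement `eR eC : BlockV b k m ≃ Fin n` of the block arsenal `G(b,k) ⊕ M₀` with `k ≥ 1`,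
a torus-homogeneous cofactor `h ∈ ℝ≥0[x_ij]` (`IsTorusHomogeneous`: all monomials share the row
margins and the column margins) and a weight `w` whose top fibre `top_w h` AGREES off the placed
face `G = placedBlock eR eC` (any two of its monomials coincide at every cell `e ∉ G`), the
projected fibre `h♭ = aeval (blockSubst eR eC) (top_w h)` is torus-homogeneous as a polynomial in
the `b × b` variables.

* The image exponent `Φ d = Σ_i Σ_ℓ d (eR (inl i), eC ℓ) • e_{(i, phaseIdx i ℓ)}` of `x^d` under
  the phase projection: the cell (core row `i`, column label `ℓ`) adds its multiplicity to the
  variable `(i, phaseIdx i ℓ)`, every other cell is sent to `1`;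
  `aeval (blockSubst eR eC) (c x^d) = c x^{Φ d}` (`aeval_blockSubst_monomial_eq`), so every
  monomial of the projection of `p` is `Φ d` for a monomial `d` of `p`
  (`exists_eq_imageExp_of_mem_support`).
* Rows (`rowDegrees_imageExp`): row `i` of `Φ d` collects ALL cells of the core row `eR (inl i)`,
  so its margin is the row margin `rowDegrees d (eR (inl i))`.
* Columns (`colDegrees_imageExp_apply`, `colDegrees_imageExp_eq`): column `j` of `Φ d` collects
  the cells of the core rows whose column label has phase `j`; those off `G` carry the
  same multiplicity in every fibre monomial, and those in `G` are exactly the hubs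
  `(inl i, (i, j, 0))` (`adj_and_phaseIdx_iff`).  The difference of two fibre monomials, pulled
  back to label coordinates, is a circulation of `G(b,k) ⊕ M₀` (`labelFlow_of_placed` of
  `…StubSparseRigidFlow`: supported on edges, vanishing row and column sums), and the path values
  of a circulation into a core column — its hub entries — sum to zero (`sum_pathVal_col`: along
  the subdivided edge `(i, j)` every internal vertex has exactly two cells, so the hub value
  propagates with alternating sign to the last cell `(row (i,j,k-1), col j)`, and the last cells
  are the only cells of core column `j`).  Hence the hub sums `Σ_i d (hub i j)` agree across the
  fibre (`sum_hub_eq`), and so do the column margins of the projected monomials.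
-/

noncomputable section

-- `Summit.ValiantsHypothesis.ValiantsHypothesis.…` is the tree's mandated single-conjunct layout
-- (Sub = Summit), so the duplicated namespace component is intended.
set_option linter.dupNamespace false

namespace Summit.ValiantsHypothesis.ValiantsHypothesis.Theorems.DivisionGapPerDivisionHard

open MvPolynomial Literature.Computability.AlgebraicComplexity
open Summit.ValiantsHypothesis.ValiantsHypothesis.Theorems.ZeroOneTransfer.Negative
open scoped NNReal

variable {b k m n : ℕ} (eR eC : BlockV b k m ≃ Fin n)

/-! ### The phase projection on monomials -/

/-- **The phase projection on monomials.**  `aeval (blockSubst eR eC)` sends the monomial `c x^d`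
to the monomial `c x^{Φ d}`, `Φ d = Σ_i Σ_ℓ d (eR (inl i), eC ℓ) • e_{(i, phaseIdx i ℓ)}`: the cell
(core row `i`, column label `ℓ`) adds its multiplicity to the variable `(i, phaseIdx i ℓ)`, cells
of internal and padding rows are sent to `1`. [folklore] -/
theorem aeval_blockSubst_monomial_eq (d : (Fin n × Fin n) →₀ ℕ) (c : ℝ≥0) :
    aeval (blockSubst eR eC) (monomial d c) =
      monomial (∑ i : Fin b, ∑ ℓ : BlockV b k m,
        Finsupp.single (i, phaseIdx i ℓ) (d (eR (Sum.inl i), eC ℓ))) c := by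
  have hprod : ∏ e, blockSubst eR eC e ^ d e =
      ∏ r : BlockV b k m, ∏ ℓ : BlockV b k m, labelSubst r ℓ ^ d (eR r, eC ℓ) := by
    rw [← Fintype.prod_prod_type']
    exact (Fintype.prod_equiv (eR.prodCongr eC) _ _ fun p => by
      rcases p with ⟨r, ℓ⟩
      simp [blockSubst]).symm
  rw [aeval_monomial, algebraMap_eq, Finsupp.prod_fintype _ _ fun _ => pow_zero _, hprod,
    Fintype.prod_sum_type]
  have h1 : ∏ y : (Fin b × Fin b × Fin k) ⊕ Fin m, ∏ ℓ : BlockV b k m,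
      labelSubst (Sum.inr y) ℓ ^ d (eR (Sum.inr y), eC ℓ) = 1 :=
    Finset.prod_eq_one fun y _ => Finset.prod_eq_one fun ℓ _ => by simp [labelSubst]
  rw [h1, mul_one, monomial_sum_index]
  congr 1
  refine Finset.prod_congr rfl fun i _ => ?_
  rw [monomial_sum_index, C_1, one_mul]
  refine Finset.prod_congr rfl fun ℓ _ => ?_
  rw [← X_pow_eq_monomial]
  rfl

/-- Every monomial of the projection of `p` is the image exponent `Φ d` of a monomial `d` of `p`
(the projection is the sum of the monomials `coeff d p · x^{Φ d}`). [folklore] -/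
theorem exists_eq_imageExp_of_mem_support {p : MvPolynomial (Fin n × Fin n) ℝ≥0}
    {x : (Fin b × Fin b) →₀ ℕ} (hx : x ∈ (aeval (blockSubst eR eC) p).support) :
    ∃ d ∈ p.support, x = ∑ i : Fin b, ∑ ℓ : BlockV b k m,
      Finsupp.single (i, phaseIdx i ℓ) (d (eR (Sum.inl i), eC ℓ)) := by
  classical
  have hsum : aeval (blockSubst eR eC) p =
      ∑ d ∈ p.support, monomial (∑ i : Fin b, ∑ ℓ : BlockV b k m,
        Finsupp.single (i, phaseIdx i ℓ) (d (eR (Sum.inl i), eC ℓ))) (coeff d p) := by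
    conv_lhs => rw [p.as_sum]
    rw [map_sum]
    exact Finset.sum_congr rfl fun d _ => aeval_blockSubst_monomial_eq eR eC d _
  rw [hsum] at hx
  obtain ⟨d, hd, hxd⟩ := Finset.mem_biUnion.mp (support_sum hx)
  exact ⟨d, hd, Finset.mem_singleton.mp (support_monomial_subset hxd)⟩

/-! ### Row margins of the image exponent -/

/-- Row `i` of the image exponent `Φ d` collects all cells of the core row `eR (inl i)`: the row
margins of `Φ d` are the row margins of `d` at the core rows. [folklore] -/
theorem rowDegrees_imageExp (d : (Fin n × Fin n) →₀ ℕ) :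
    rowDegrees (∑ i : Fin b, ∑ ℓ : BlockV b k m,
        Finsupp.single (i, phaseIdx i ℓ) (d (eR (Sum.inl i), eC ℓ))) =
      ∑ i : Fin b, Finsupp.single i (rowDegrees d (eR (Sum.inl i))) := by
  show Finsupp.mapDomain Prod.fst _ = _
  simp only [Finsupp.mapDomain_finsetSum, Finsupp.mapDomain_single]
  refine Finset.sum_congr rfl fun i _ => ?_
  rw [← Finsupp.single_finsetSum, rowDegrees_apply]
  congr 1
  exact Equiv.sum_comp eC fun c => d (eR (Sum.inl i), c)

/-! ### Column margins of the image exponent -/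

/-- Column `j` of the image exponent `Φ d` collects the cells of the core rows whose column label
has phase `j`. [folklore] -/
theorem colDegrees_imageExp_apply (d : (Fin n × Fin n) →₀ ℕ) (j : Fin b) :
    Finsupp.mapDomain Prod.snd (∑ i : Fin b, ∑ ℓ : BlockV b k m,
        Finsupp.single (i, phaseIdx i ℓ) (d (eR (Sum.inl i), eC ℓ))) j =
      ∑ i : Fin b, ∑ ℓ : BlockV b k m,
        if phaseIdx i ℓ = j then d (eR (Sum.inl i), eC ℓ) else 0 := by
  simp only [Finsupp.mapDomain_finsetSum, Finsupp.mapDomain_single,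
    Finsupp.coe_finsetSum, Finset.sum_apply, Finsupp.single_apply]

/-- Among the column labels of phase `j`, the core row `i` is adjacent (`k ≥ 1`) exactly to the
hub column `(i, j, 0)` of the path `(i, j)`. [folklore] -/
theorem adj_and_phaseIdx_iff (hk : 0 < k) (i j : Fin b) (ℓ : BlockV b k m) :
    (blockAdj b k m (Sum.inl i) ℓ = true ∧ phaseIdx i ℓ = j) ↔ ℓ = iv i j ⟨0, hk⟩ := by
  constructor
  · rintro ⟨hadj, rfl⟩
    obtain ⟨j', rfl⟩ := adj_coreRow hk hadj
    rfl
  · rintro rfl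
    exact ⟨by simp [blockAdj], rfl⟩

/-- **The hub sums are constants of the fibre.**  If two exponent vectors have the same row and
column margins and agree off the placed face (`k ≥ 1`), then for every core column index `j`
their hub multiplicities `d (eR (inl i), eC (i, j, 0))` have the same sum over `i`: the
difference `d₁ - d₂`, pulled back to label coordinates, is a circulation of `G(b,k) ⊕ M₀`
(`labelFlow_of_placed`), and the path values of a circulation into a core column sum to zero
(`sum_pathVal_col`). [folklore] -/
theorem sum_hub_eq (hk : 0 < k) {d₁ d₂ : (Fin n × Fin n) →₀ ℕ}
    (hrow : rowDegrees d₁ = rowDegrees d₂)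
    (hcol : Finsupp.mapDomain Prod.snd d₁ = Finsupp.mapDomain Prod.snd d₂)
    (hoff : ∀ e ∉ placedBlock eR eC, d₁ e = d₂ e) (j : Fin b) :
    ∑ i, d₁ (eR (Sum.inl i), eC (iv i j ⟨0, hk⟩)) =
      ∑ i, d₂ (eR (Sum.inl i), eC (iv i j ⟨0, hk⟩)) := by
  -- the difference is supported on the placed face and has vanishing margins
  have hG : ∀ e, (d₁ e : ℤ) - d₂ e ≠ 0 → e ∈ placedBlock eR eC := fun e he => by
    by_contra hmem
    exact he (by rw [hoff e hmem, sub_self])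
  have hrow' : ∀ r, ∑ c, ((d₁ (r, c) : ℤ) - d₂ (r, c)) = 0 := fun r => by
    rw [Finset.sum_sub_distrib, sub_eq_zero]
    exact_mod_cast show ∑ c, d₁ (r, c) = ∑ c, d₂ (r, c) by
      rw [← rowDegrees_apply, ← rowDegrees_apply, hrow]
  have hcol' : ∀ c, ∑ r, ((d₁ (r, c) : ℤ) - d₂ (r, c)) = 0 := fun c => by
    rw [Finset.sum_sub_distrib, sub_eq_zero]
    exact_mod_cast show ∑ r, d₁ (r, c) = ∑ r, d₂ (r, c) by
      rw [← colDegrees_apply, ← colDegrees_apply, hcol]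
  have hF := labelFlow_of_placed eR eC (D := fun e => (d₁ e : ℤ) - d₂ e) hG hrow' hcol'
  have h := sum_pathVal_col hF hk j
  simp only [pathVal] at h
  rw [Finset.sum_sub_distrib, sub_eq_zero] at h
  exact_mod_cast h

/-- **Column margins of the projected fibre.**  Two exponent vectors with the same margins that
agree off the placed face (`k ≥ 1`) project to exponents with the same column margins: column `j`
of `Φ d` is the hub sum `Σ_i d (hub i j)` (`sum_hub_eq`) plus the multiplicities of cells off the
face, which agree. [folklore] -/
theorem colDegrees_imageExp_eq (hk : 0 < k) {d₁ d₂ : (Fin n × Fin n) →₀ ℕ}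
    (hrow : rowDegrees d₁ = rowDegrees d₂)
    (hcol : Finsupp.mapDomain Prod.snd d₁ = Finsupp.mapDomain Prod.snd d₂)
    (hoff : ∀ e ∉ placedBlock eR eC, d₁ e = d₂ e) :
    Finsupp.mapDomain Prod.snd (∑ i : Fin b, ∑ ℓ : BlockV b k m,
        Finsupp.single (i, phaseIdx i ℓ) (d₁ (eR (Sum.inl i), eC ℓ))) =
      Finsupp.mapDomain Prod.snd (∑ i : Fin b, ∑ ℓ : BlockV b k m,
        Finsupp.single (i, phaseIdx i ℓ) (d₂ (eR (Sum.inl i), eC ℓ))) := by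
  ext j
  rw [colDegrees_imageExp_apply, colDegrees_imageExp_apply]
  -- split the inner sums at the hub cell
  have hsplit : ∀ (d : (Fin n × Fin n) →₀ ℕ) (i : Fin b),
      (∑ ℓ : BlockV b k m, if phaseIdx i ℓ = j then d (eR (Sum.inl i), eC ℓ) else 0) =
        d (eR (Sum.inl i), eC (iv i j ⟨0, hk⟩)) +
          ∑ ℓ : BlockV b k m, if phaseIdx i ℓ = j ∧ blockAdj b k m (Sum.inl i) ℓ ≠ true then
            d (eR (Sum.inl i), eC ℓ) else 0 := by
    intro d i
    have hterm : ∀ ℓ : BlockV b k m,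
        (if phaseIdx i ℓ = j then d (eR (Sum.inl i), eC ℓ) else 0) =
          (if ℓ = iv i j ⟨0, hk⟩ then d (eR (Sum.inl i), eC ℓ) else 0) +
            if phaseIdx i ℓ = j ∧ blockAdj b k m (Sum.inl i) ℓ ≠ true then
              d (eR (Sum.inl i), eC ℓ) else 0 := by
      intro ℓ
      have hiff := adj_and_phaseIdx_iff hk i j ℓ
      by_cases hP : phaseIdx i ℓ = j
      · by_cases hA : blockAdj b k m (Sum.inl i) ℓ = true
        · rw [if_pos hP, if_pos (hiff.1 ⟨hA, hP⟩), if_neg (fun h => h.2 hA), add_zero]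
        · rw [if_pos hP, if_neg (fun h => hA (hiff.2 h).1), if_pos ⟨hP, hA⟩, zero_add]
      · rw [if_neg hP, if_neg (fun h => hP (hiff.2 h).2), if_neg (fun h => hP h.1), zero_add]
    rw [Finset.sum_congr rfl fun ℓ _ => hterm ℓ, Finset.sum_add_distrib, Fintype.sum_ite_eq']
  rw [Finset.sum_congr rfl fun i _ => hsplit d₁ i, Finset.sum_congr rfl fun i _ => hsplit d₂ i,
    Finset.sum_add_distrib, Finset.sum_add_distrib, sum_hub_eq eR eC hk hrow hcol hoff j]
  congr 1
  refine Finset.sum_congr rfl fun i _ => Finset.sum_congr rfl fun ℓ _ => ?_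
  split_ifs with h
  · exact hoff _ (by simpa [placedBlock] using h.2)
  · rfl

/-! ### The stub -/

/-- **`stub_fibreTorus` (line `pair-descent-jss-endpoint`, v9.2).**  For `k ≥ 1`, a
torus-homogeneous `h` and a weight `w` whose top fibre agrees off the placed face
`G = placedBlock eR eC`, the projected fibre `aeval (blockSubst eR eC) (top_w h)` is
torus-homogeneous (as a polynomial in the `b × b` variables).  Its monomials are the image
exponents `Φ d` of fibre monomials `d` (`exists_eq_imageExp_of_mem_support`); row `i` of `Φ d`
collects all cells of core row `eR (inl i)`, so its margin is a row margin of `h`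
(`rowDegrees_imageExp`); column `j` collects the cells of core rows whose column label has phase
`j`: all of them are off `G` (fixed across the fibre) except the hubs `(inl i, (i, j, 0))`, whose
multiplicities have a fixed sum over `i` because the difference of two fibre monomials is a
circulation of `G(b,k) ⊕ M₀` (`colDegrees_imageExp_eq`, `sum_hub_eq`, `sum_pathVal_col`).
[folklore] -/
theorem stub_fibreTorus :
    ∀ (b k m n : ℕ) (eR eC : BlockV b k m ≃ Fin n) (w : Fin n × Fin n → ℕ)
      (h : MvPolynomial (Fin n × Fin n) ℝ≥0), 0 < k → IsTorusHomogeneous h →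
      (∀ m₁ ∈ (topComponent w h).support, ∀ m₂ ∈ (topComponent w h).support,
        ∀ e ∉ placedBlock eR eC, m₁ e = m₂ e) →
      IsTorusHomogeneous (aeval (blockSubst eR eC) (topComponent w h)) := by
  intro b k m n eR eC w h hk htor hagree
  classical
  obtain ⟨R, Cc, hRC⟩ := htor
  by_cases hne : (topComponent w h).support.Nonempty
  · obtain ⟨d₀, hd₀⟩ := hne
    refine ⟨rowDegrees (∑ i : Fin b, ∑ ℓ : BlockV b k m,
        Finsupp.single (i, phaseIdx i ℓ) (d₀ (eR (Sum.inl i), eC ℓ))),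
      Finsupp.mapDomain Prod.snd (∑ i : Fin b, ∑ ℓ : BlockV b k m,
        Finsupp.single (i, phaseIdx i ℓ) (d₀ (eR (Sum.inl i), eC ℓ))), ?_⟩
    intro x hx
    obtain ⟨d, hd, rfl⟩ := exists_eq_imageExp_of_mem_support eR eC hx
    have h₁ := hRC d (support_topComponent_subset w h hd)
    have h₀ := hRC d₀ (support_topComponent_subset w h hd₀)
    have hrow : rowDegrees d = rowDegrees d₀ := h₁.1.trans h₀.1.symm
    have hcol : Finsupp.mapDomain Prod.snd d = Finsupp.mapDomain Prod.snd d₀ :=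
      h₁.2.trans h₀.2.symm
    exact ⟨by rw [rowDegrees_imageExp, rowDegrees_imageExp, hrow],
      colDegrees_imageExp_eq eR eC hk hrow hcol (hagree d hd d₀ hd₀)⟩
  · rw [Finset.not_nonempty_iff_eq_empty, support_eq_empty] at hne
    refine ⟨0, 0, fun x hx => ?_⟩
    rw [hne, map_zero, support_zero] at hx
    exact absurd hx (Finset.notMem_empty _)

end Summit.ValiantsHypothesis.ValiantsHypothesis.Theorems.DivisionGapPerDivisionHard

end
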